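import Summits.CriticalPhenomena.PercolationContinuityZ3.Theorems.PercNearOneGluingNoHeavyQuantFarGate3Strip0
import Summits.CriticalPhenomena.PercolationContinuityZ3.Theorems.PercNearOneGluingNoHeavyQuantFarGate3PinchWAll
import Summits.CriticalPhenomena.PercolationContinuityZ3.Theorems.PercNearOneGluingNoHeavyQuantFarGate3PinchRAll
import Summits.CriticalPhenomena.PercolationContinuityZ3.Theorems.PercNearOneGluingNoHeavyQuantFarGate3PinchUAll
import Summits.CriticalPhenomena.PercolationContinuityZ3.Theorems.PercNearOneGluingNoHeavyQuantFarGate3PinchPAll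
import Summits.CriticalPhenomena.PercolationContinuityZ3.Theorems.PercNearOneGluingNoHeavyQuantFarGate3PinchMAll
import HarnessLib

/-!
# QUANT lane R8, front "FAR beyond trees", layer one — THE DEGREE-THREE GATE AT THE OBSERVER, LXXIV: STRIP 0 below `p = 1/20` — `Gate3.red8_strip0`

builds on p205010 (kernel theorem, internal audit signed; external expert review pending)

Support file (`--supports stmt-CriticalPhenomena-4575`), seat `prim-quant-p1` (gens 35–36); memos `run/shared/lean/prim/quant/prim-quant-p1-g35/FOR-LEAD-GATE3-PINCH.md`,
`…/prim-quant-p1-g36/FOR-LEAD-GATE3-PINCH2.md` (the certificate data: P 5, U 12, M 2, W 93, R ≈ 250 kernel-checked box certificates).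
File LXXIII (`red8_strip0_of_data`) with its five data hypotheses discharged by the chart masters `pinchW_all … pinchM_all`; standard axioms; no sorries.
[this work].
-/

namespace Summit.CriticalPhenomena.PercolationContinuityZ3.Theorems

namespace Quant

namespace Gate3

/-- **Strip 0 of the degree-three gate below `p = 1/20`**: `0 < p < 1/20`, `nn ≥ 1`, `0 ≤ r₁ ≤ 1/10`, `4/5 ≤ r₂ < 1`. [this work] -/
theorem red8_strip0 (p r₁ r₂ nn : ℝ) (hp0 : 0 < p) (hp : p < (1 : ℝ) / 20) (hr10 : 0 ≤ r₁) (h1hi : r₁ ≤ (1 : ℝ) / 10)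
    (h2lo : (4 : ℝ) / 5 ≤ r₂) (hr2 : r₂ < 1) (hn : 1 ≤ nn) :
    ∀ (a0 a1 a2 b1 b2 c0 c1 d : ℝ), 0 ≤ a0 → 0 ≤ a1 → 0 ≤ a2 → 0 ≤ b1 → 0 ≤ b2 → 0 ≤ c0 → 0 ≤ c1 → 0 ≤ d →
    b1 * (b2 + (c0 + c1)) ≤ (a0 + a1 + a2) * d →
    b2 * (b1 + (c0 + c1)) ≤ (a0 + a1 + a2) * d →
    (c0 + c1) * (b1 + b2) ≤ (a0 + a1 + a2) * d →
    b1 * (a1 + a2 + c1 + d) ≤ d * (a0 + b1 + b2 + c0) →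
    b2 * (a1 + a2 + c1 + d) ≤ d * (a0 + b1 + b2 + c0) →
    c0 * (a1 + a2 + c1 + d) ≤ (c1 + d) * (a0 + b1 + b2 + c0) →
    0 < p * ((1 - r₁) * (1 - r₂)) * (a0 + c0) - (1 - p) * a2 - (1 - p) * ((1 - r₁) * (1 - r₂)) * d →
    0 < (1 - p) * (1 - r₁) * b1 - p * (r₂ * (1 - r₁)) * a0 - p * (1 - r₁) * a1 - (1 - p * r₁) * a2 - (1 - (1 - p) * (1 - r₂)) * (1 - r₁) * b2 - p * ((1 - r₁) * (1 - r₂)) * c1 →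
    0 < (1 - p) * (1 - r₂) * b2 - p * (r₁ * (1 - r₂)) * a0 - p * (1 - r₂) * a1 - (1 - p * r₂) * a2 - (1 - (1 - p) * (1 - r₁)) * (1 - r₂) * b1 - p * ((1 - r₁) * (1 - r₂)) * c1 →
    0 < (1 - p * max r₁ r₂ - nn * p * (1 - max r₁ r₂)) * a1 + (1 - p * (r₁ + r₂ * (1 - r₁)) - nn * p * ((1 - r₁) * (1 - r₂))) * c1 - nn * p * (r₁ + r₂ * (1 - r₁) - max r₁ r₂) * a0 - nn * ((1 - (1 - p) * (1 - r₁)) * (1 - r₂)) * b1 - nn * ((1 - (1 - p) * (1 - r₂)) * (1 - r₁)) * b2 →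
    0 < (p * (1 + r₁ + r₂ + nn * max r₁ r₂) - 2) * a0 + (p * (1 + r₁ + r₂) + p * max r₁ r₂ * (nn - 1) - 1) * a1 + (p * (1 + r₁ + r₂) + nn - 2) * a2 + ((1 - (1 - p) * (1 - r₁)) * (1 + r₂ * (nn + 1)) - 1) * b1 + ((1 - (1 - p) * (1 - r₂)) * (1 + r₁ * (nn + 1)) - 1) * b2 + (p * (1 + (nn + 2) * (r₁ + r₂ * (1 - r₁))) - 2) * c0 + (p * (1 + (nn + 1) * (r₁ + r₂ * (1 - r₁))) - 1) * c1 + (nn + 1 - (1 - p) * ((1 - r₁) * (1 - r₂))) * d →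
    False
     :=
  red8_strip0_of_data p r₁ r₂ nn hp0 hp hr10 h1hi h2lo hr2 hn pinchW_all pinchR_all pinchU_all pinchP_all pinchM_all

end Gate3

end Quant

end Summit.CriticalPhenomena.PercolationContinuityZ3.Theorems
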